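import Mathlib
import HarnessLib
import Literature.Analysis.FluidPDE.Seregin2020AncientLimit
import Literature.Analysis.FluidPDE.Seregin2020BlowupLimitAlong

/-!
# Seregin 2020, proof of Thm. 2.1: the blow-up limit at a Type I singular point ALONG A PRESCRIBED null sequence
# of scales, with an imported `L³`-floor

`Literature.Analysis.FluidPDE.Seregin2020.exists_ancientLimit` (`Seregin2020AncientLimit.lean`) extracts the blow-up
limit of a suitable weak solution at a Type I singular vertex along scales of the tree's choosing (a subsequence of
the dyadic scales).  The printed procedure ("Let `λₖ → 0` be a sequence and let `uᵏ(y,s) = λₖ v(x,t)` …; passing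
`k → ∞` we can find limit functions", Seregin 2020, proof of Thm. 2.1; Seregin 2014, Prop. 6.20) runs along ANY null
sequence, a subsequence being extracted.  This file proves that form, `exists_ancientLimit_along`: the scales of the
converging zooms are `μ_{φ(j)}` for the GIVEN positive null sequence `μ` and a strictly increasing `φ`.  The
non-triviality is imported rather than re-derived: any floor `κ₀ ≤ C(u; r, 0)` for `0 < r ≤ r₂` (e.g. Seregin's
`κ(L)` of `Seregin2020CubicLowerBound.exists_le_cknC_of_isBackwardSingularPoint`, (2.9)) passes to the limit as
`κ₀ ≤ C(w; a, 0)` for EVERY `a > 0` (scale invariance of `C` + strong `L³` convergence); the limit is backward-singular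
at the origin (persistence of singularities, Albritton–Barker 2019 Prop. 2.3, tree `PersistenceOfSingularities_holds`).
Proof = the tree's proof of `exists_ancientLimit` with the extraction `exists_zoom_blowup_limit_along`
(`Seregin2020BlowupLimitAlong.lean`) in place of the dyadic one, after pre-zooming to a radius below both Seregin's
`r₁` ((2.8)) and the floor radius `r₂`, and passing to a subsequence of `μₙ/r₁` below the dyadic scales.

Consumer: the prescribed-time zoom of the sequential ε-doors of LADDER-NS N0 (door S26, SEED-26 input I1,
`StableStrataDoorOneSliceDefs.LocalPointZoomAlongTimesM`).  WHAT THIS IS NOT: no new mathematics beyond the printed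
generality; not a claim about Navier–Stokes regularity.

## References

* G. Seregin, Anal. Math. Phys. 10 (2020), Paper 46 = arXiv:2006.04140, proof of Thm. 2.1, (2.8)–(2.9),
  properties (𝒜). [Seregin2020]
* G. Seregin, *Lecture Notes on Regularity Theory for the Navier–Stokes Equations*, World Scientific 2014, §6.6,
  Prop. 6.20. [Seregin2014]
* D. Albritton, T. Barker, Arch. Ration. Mech. Anal. 232 (2019), Prop. 2.3. [AlbrittonBarker2019]
-/

noncomputable section

open MeasureTheory Set Function Filter Topology TopologicalSpace Metric
open scoped NNReal ENNReal

namespace Literature.Analysis.FluidPDE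

namespace Seregin2020

/-- Every null sequence of reals has a subsequence dominated by the dyadic scales `2^{-(n+2)}`. [folklore] -/
private theorem exists_subseq_le_dyadic {μ : ℕ → ℝ} (hμ0 : Tendsto μ atTop (𝓝 0)) :
    ∃ ψ : ℕ → ℕ, StrictMono ψ ∧ ∀ n, μ (ψ n) ≤ (1 / 2 : ℝ) ^ (n + 2) := by
  refine extraction_forall_of_eventually (P := fun n k => μ k ≤ (1 / 2 : ℝ) ^ (n + 2)) fun n => ?_
  exact (hμ0.eventually (gt_mem_nhds (by positivity : (0 : ℝ) < (1 / 2 : ℝ) ^ (n + 2)))).mono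
    fun k hk => hk.le

/-- **Non-triviality of a blow-up limit along general scales** (Seregin 2014, (6.6.1); ESS 2003, §3 (3.16); dyadic
version: `blowup_lintegral_cube_ge_of`): at a point `z₀` with `C(ρ; z₀) ≥ η` for all `0 < ρ ≤ 1/2`, a strong
`L³(Q(a))` limit `w` of the rescaled velocities `u^{μ_j}` (`0 < μ_j`, `a μ_j ≤ 1/2` for `j ≥ j₀`) satisfies
`∫_{Q(a)} |w|³ ≥ η a²`. [cite: Seregin2014, §6.6 Prop. 6.20 (6.6.1)] [cite: EscauriazaSereginSverak2003, §3 (3.16)] -/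
theorem lintegral_cube_ge_of_tendsto_along
    {v : ℝ → EuclideanSpace ℝ (Fin 3) → EuclideanSpace ℝ (Fin 3)} {z₀ : ℝ × EuclideanSpace ℝ (Fin 3)}
    (hv : AEStronglyMeasurable (uncurry v) (volume.restrict (parabolicCylinder (1 / 2) z₀)))
    {η : ℝ} (hη : ∀ ρ ∈ Ioc (0 : ℝ) (1 / 2), ENNReal.ofReal η ≤ cknC ρ z₀ v)
    {mu : ℕ → ℝ} (hmu : ∀ j, 0 < mu j) {a : ℝ} (ha : 0 < a) {j₀ : ℕ}
    (hj₀ : ∀ j, j₀ ≤ j → a * mu j ≤ 1 / 2)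
    {w : ℝ → EuclideanSpace ℝ (Fin 3) → EuclideanSpace ℝ (Fin 3)}
    (hw : AEStronglyMeasurable (uncurry w)
      (volume.restrict (parabolicCylinder a (0 : ℝ × EuclideanSpace ℝ (Fin 3)))))
    (hconv : Tendsto (fun j => eLpNorm
        (uncurry ((mu j) • stPull ((mu j) ^ 2) (mu j) z₀.1 z₀.2 v) - uncurry w) 3
        (volume.restrict (parabolicCylinder a (0 : ℝ × EuclideanSpace ℝ (Fin 3)))))
      atTop (𝓝 0)) :
    ENNReal.ofReal (a ^ 2 * η) ≤
      ∫⁻ z in parabolicCylinder a (0 : ℝ × EuclideanSpace ℝ (Fin 3)), ‖w z.1 z.2‖ₑ ^ (3 : ℕ) := by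
  set U : ℕ → ℝ → EuclideanSpace ℝ (Fin 3) → EuclideanSpace ℝ (Fin 3) :=
    fun j => (mu j) • stPull ((mu j) ^ 2) (mu j) z₀.1 z₀.2 v with hU
  set μ' : Measure (ℝ × EuclideanSpace ℝ (Fin 3)) :=
    volume.restrict (parabolicCylinder a (0 : ℝ × EuclideanSpace ℝ (Fin 3))) with hμ'
  -- the lower bound and the measurability of the approximants, for `j ≥ j₀`
  have hlow : ∀ j, j₀ ≤ j → ENNReal.ofReal (a ^ 2 * η) ≤ ∫⁻ z, ‖uncurry (U j) z‖ₑ ^ (3 : ℕ) ∂μ' :=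
    fun j hj => ofReal_sq_mul_eta_le_lintegral_cube_zoom hη (hmu _) ha (hj₀ j hj)
  have hmeas : ∀ j, j₀ ≤ j → AEStronglyMeasurable (uncurry (U j)) μ' :=
    fun j hj => aestronglyMeasurable_uncurry_zoom_of hv (hmu _) ha (hj₀ j hj)
  have hconv' : Tendsto (fun j => eLpNorm (uncurry (U j) - uncurry w) 3 μ') atTop (𝓝 0) := hconv
  -- `b = (a² η)^{1/3} ≤ ‖U_j‖₃ ≤ ‖w‖₃ + ‖U_j - w‖₃`
  set b : ℝ≥0∞ := (ENNReal.ofReal (a ^ 2 * η)) ^ (1 / 3 : ℝ) with hb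
  have hble : ∀ j, j₀ ≤ j → b ≤ eLpNorm (uncurry w) 3 μ' + eLpNorm (uncurry (U j) - uncurry w) 3 μ' := by
    intro j hj
    have h1 : b ≤ eLpNorm (uncurry (U j)) 3 μ' := by
      rw [hb, eLpNorm_three_eq_lintegral_cube_rpow]
      exact ENNReal.rpow_le_rpow (hlow j hj) (by norm_num)
    refine h1.trans ?_
    have e : uncurry (U j) = uncurry w + (uncurry (U j) - uncurry w) := by abel
    calc eLpNorm (uncurry (U j)) 3 μ' = eLpNorm (uncurry w + (uncurry (U j) - uncurry w)) 3 μ' := by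
          rw [← e]
      _ ≤ eLpNorm (uncurry w) 3 μ' + eLpNorm (uncurry (U j) - uncurry w) 3 μ' :=
          eLpNorm_add_le hw ((hmeas j hj).sub hw) (by norm_num)
  have hlim : Tendsto (fun j => eLpNorm (uncurry w) 3 μ' + eLpNorm (uncurry (U j) - uncurry w) 3 μ')
      atTop (𝓝 (eLpNorm (uncurry w) 3 μ')) := by
    have := (tendsto_const_nhds (x := eLpNorm (uncurry w) 3 μ') (f := (atTop : Filter ℕ))).add hconv'
    rwa [add_zero] at this
  have hb_le : b ≤ eLpNorm (uncurry w) 3 μ' :=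
    ge_of_tendsto hlim (eventually_atTop.2 ⟨j₀, fun j hj => hble j hj⟩)
  have h3 := ENNReal.rpow_le_rpow hb_le (by norm_num : (0 : ℝ) ≤ 3)
  rw [hb, ← ENNReal.rpow_mul, show (1 / 3 : ℝ) * 3 = 1 by norm_num, ENNReal.rpow_one,
    eLpNorm_three_eq_lintegral_cube_rpow, ← ENNReal.rpow_mul,
    show (1 / 3 : ℝ) * 3 = 1 by norm_num, ENNReal.rpow_one] at h3
  exact h3


/-- **Seregin 2020, proof of Thm. 2.1: the blow-up limit at a Type I singular vertex ALONG A PRESCRIBED null sequence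
of scales** (properties (𝒜)(i), the singularity of the limit, and an imported non-triviality floor).  Let `(u, p)`
be a suitable weak solution of the unforced Navier–Stokes equations (`ν = 1`) on `Q = 𝒞 × ]-1, 0[` with the global
classes of Def. 1.3, `G` a weak spatial gradient, the origin a backward singular point of Type I (`g(0) < ∞`), and
let `κ₀ ≤ C(u; r, 0)` for `0 < r ≤ r₂` (any floor; `κ₀ ≤ 0` is allowed and says nothing).  Then for every positive
null sequence `μₙ` there are a strictly increasing `φ` and a pair `(w, π)` such that for every `a > 0`: `(w, π)` is a
suitable weak solution in `Q(a)` with `w ∈ L³(Q(a))`; the rescaled velocities `μ_{φ j} u(μ_{φ j}² s, μ_{φ j} y)`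
converge to `w` in `L³(Q(a))` and the rescaled pressures `μ_{φ j}² p(μ_{φ j}² s, μ_{φ j} y)` converge to `π` weakly in
`L^{3/2}(Q(a))`; `C(w; a) ≥ κ₀`; moreover the origin is a backward singular point of `w`.
[cite: Seregin2020, proof of Thm. 2.1, (2.8)–(2.9) and properties (𝒜)(i)] [cite: Seregin2014, §6.6 Prop. 6.20] -/
theorem exists_ancientLimit_along
    {u : ℝ → EuclideanSpace ℝ (Fin 3) → EuclideanSpace ℝ (Fin 3)}
    {p : ℝ → EuclideanSpace ℝ (Fin 3) → ℝ}
    {G : ℝ → EuclideanSpace ℝ (Fin 3) → EuclideanSpace ℝ (Fin 3) →L[ℝ] EuclideanSpace ℝ (Fin 3)}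
    (hsw : IsSuitableWeakSolutionOn (SereginSverak2009.parCylOpens 0 1) 1 0 u p)
    (hA : ∃ C : ℝ≥0, ∀ᵐ t ∂(volume.restrict (Ioo (-1 : ℝ) 0)),
      ∫⁻ x in SereginSverak2009.spaceCyl 0 1, ‖u t x‖ₑ ^ 2 ≤ C)
    (hG : HasWeakSpatialGradientOn (SereginSverak2009.parCylOpens 0 1) u G)
    (hE : ∫⁻ z in SereginSverak2009.parCyl 0 1, ENNReal.ofReal (frobeniusNormSq (G z.1 z.2)) < ∞)
    (hp : ∫⁻ z in SereginSverak2009.parCyl 0 1, ‖p z.1 z.2‖ₑ ^ (3 / 2 : ℝ) < ∞)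
    (hsing : IsBackwardSingularPoint u 0) (hI : blowupIndex 0 u G < ∞)
    {κ₀ r₂ : ℝ} (hr₂ : 0 < r₂)
    (hκ₀ : ∀ r ∈ Ioc (0 : ℝ) r₂, ENNReal.ofReal κ₀ ≤ cknC r (0 : ℝ × EuclideanSpace ℝ (Fin 3)) u)
    {μ : ℕ → ℝ} (hμ : ∀ n, 0 < μ n) (hμ0 : Tendsto μ atTop (𝓝 0)) :
    ∃ (φ : ℕ → ℕ)
      (w : ℝ → EuclideanSpace ℝ (Fin 3) → EuclideanSpace ℝ (Fin 3))
      (π : ℝ → EuclideanSpace ℝ (Fin 3) → ℝ),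
      StrictMono φ ∧
      IsBackwardSingularPoint w 0 ∧
      ∀ a : ℝ, 0 < a →
        IsSuitableWeakSolutionInBall a 0 w π ∧
        MemLp (uncurry w) 3
          (volume.restrict (parabolicCylinder a (0 : ℝ × EuclideanSpace ℝ (Fin 3)))) ∧
        Tendsto (fun j => eLpNorm
            (uncurry ((μ (φ j)) • stPull ((μ (φ j)) ^ 2) (μ (φ j)) (0 : ℝ)
              (0 : EuclideanSpace ℝ (Fin 3)) u) - uncurry w) 3
            (volume.restrict (parabolicCylinder a (0 : ℝ × EuclideanSpace ℝ (Fin 3)))))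
          atTop (𝓝 0) ∧
        (∀ g : ℝ × EuclideanSpace ℝ (Fin 3) → ℝ,
          MemLp g 3 (volume.restrict (parabolicCylinder a (0 : ℝ × EuclideanSpace ℝ (Fin 3)))) →
          Tendsto (fun j => ∫ w' in parabolicCylinder a (0 : ℝ × EuclideanSpace ℝ (Fin 3)),
              ((μ (φ j)) ^ 2 • stPull ((μ (φ j)) ^ 2) (μ (φ j)) (0 : ℝ)
                (0 : EuclideanSpace ℝ (Fin 3)) p) w'.1 w'.2 * g w')
            atTop (𝓝 (∫ w' in parabolicCylinder a (0 : ℝ × EuclideanSpace ℝ (Fin 3)),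
              π w'.1 w'.2 * g w'))) ∧
        ENNReal.ofReal κ₀ ≤ cknC a (0 : ℝ × EuclideanSpace ℝ (Fin 3)) w := by
  classical
  -- ### (2.8)–(2.9) for `v`, and the class on the unit ball
  obtain ⟨K, κ, hκ, r₀, hr₀, hr₀1, hKκ⟩ := typeI_singular_scaledEnergies hsw hA hG hE hp hsing hI
  -- the pre-zoom radius: below `r₀` (scaled-energy bounds) and below `r₂` (the input floor)
  set r₁ : ℝ := min r₀ r₂ with hr₁def
  have hr₁ : 0 < r₁ := lt_min hr₀ hr₂
  have hr₁1 : r₁ ≤ 1 := (min_le_left _ _).trans hr₀1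
  have hr₁r₀ : r₁ ≤ r₀ := min_le_left _ _
  have hr₁r₂ : r₁ ≤ r₂ := min_le_right _ _
  have hball := isSuitableWeakSolutionInBall_one hsw hA hG hE hp
  have hQ : parabolicCylinder 1 (0 : ℝ × EuclideanSpace ℝ (Fin 3)) ⊆
      ((SereginSverak2009.parCylOpens 0 1 : Opens (ℝ × EuclideanSpace ℝ (Fin 3))) :
        Set (ℝ × EuclideanSpace ℝ (Fin 3))) := by
    rw [SereginSverak2009.coe_parCylOpens]
    exact parabolicCylinder_subset_parCyl 0 1
  -- ### the pre-zoomed pair `v' = r₁ u(r₁² s, r₁ y)`, `p' = r₁² p(r₁² s, r₁ y)`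
  set z₀ : ℝ × EuclideanSpace ℝ (Fin 3) := ((0 : ℝ), (0 : EuclideanSpace ℝ (Fin 3))) with hz₀
  have hz₀0 : z₀ = 0 := rfl
  set v' : ℝ → EuclideanSpace ℝ (Fin 3) → EuclideanSpace ℝ (Fin 3) :=
    r₁ • stPull (r₁ ^ 2) r₁ (0 : ℝ) (0 : EuclideanSpace ℝ (Fin 3)) u with hv'
  set p' : ℝ → EuclideanSpace ℝ (Fin 3) → ℝ :=
    r₁ ^ 2 • stPull (r₁ ^ 2) r₁ (0 : ℝ) (0 : EuclideanSpace ℝ (Fin 3)) p with hp'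
  have hzoomv : ∀ c : ℝ, c • stPull (c ^ 2) c z₀.1 z₀.2 v' =
      (c * r₁) • stPull ((c * r₁) ^ 2) (c * r₁) (0 : ℝ) (0 : EuclideanSpace ℝ (Fin 3)) u := by
    intro c
    show c • stPull (c ^ 2) c 0 0 v' = _
    rw [hv', zoom_zoom]
  have hzoomp : ∀ c : ℝ, c ^ 2 • stPull (c ^ 2) c z₀.1 z₀.2 p' =
      (c * r₁) ^ 2 • stPull ((c * r₁) ^ 2) (c * r₁) (0 : ℝ) (0 : EuclideanSpace ℝ (Fin 3)) p := by
    intro c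
    show c ^ 2 • stPull (c ^ 2) c 0 0 p' = _
    rw [hp', zoom_zoom, mul_pow]
  have hst : ∀ β γ : ℝ, stAffine β γ z₀.1 z₀.2 (0 : ℝ × EuclideanSpace ℝ (Fin 3)) = z₀ := by
    intro β γ
    rw [hz₀0]
    exact stAffine_zero_zero_apply_zero β γ
  -- ### the three inputs of the extraction
  have hu_meas : AEStronglyMeasurable (uncurry u)
      (volume.restrict (parabolicCylinder (1 / 2) z₀)) := by
    refine (hG.locallyIntegrableOn.aestronglyMeasurable).mono_measure (Measure.restrict_mono ?_ le_rfl)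
    rw [hz₀0]
    exact (parabolicCylinder_mono (by norm_num) (by norm_num) _).trans hQ
  have hp_meas : AEStronglyMeasurable (uncurry p)
      (volume.restrict (parabolicCylinder (1 / 2) z₀)) := by
    refine hsw.distributional.2.2.1.aestronglyMeasurable.mono_measure (Measure.restrict_mono ?_ le_rfl)
    rw [hz₀0]
    exact (parabolicCylinder_mono (by norm_num) (by norm_num) _).trans hQ
  have hr₁half : 1 / 2 * r₁ ≤ 1 / 2 := by linarith
  have hv'_meas : AEStronglyMeasurable (uncurry v')
      (volume.restrict (parabolicCylinder (1 / 2) z₀)) := by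
    have h1 := aestronglyMeasurable_uncurry_zoom_of hu_meas hr₁ (by norm_num : (0 : ℝ) < 1 / 2)
      hr₁half
    rw [hz₀0]
    exact h1
  have hp'_meas : AEStronglyMeasurable (uncurry p')
      (volume.restrict (parabolicCylinder (1 / 2) z₀)) := by
    have h1 := aestronglyMeasurable_uncurry_zoom_pressure_of hp_meas hr₁
      (by norm_num : (0 : ℝ) < 1 / 2) hr₁half
    rw [hz₀0]
    exact h1
  have hsuit : ∀ c ∈ Ioc (0 : ℝ) (1 / 2), IsSuitableWeakSolutionInBall 1 0
      (c • stPull (c ^ 2) c z₀.1 z₀.2 v') (c ^ 2 • stPull (c ^ 2) c z₀.1 z₀.2 p') := by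
    intro c hc
    have hcr : 0 < c * r₁ := mul_pos hc.1 hr₁
    have h1 := hball.zoomOut hcr
    have hle : (1 : ℝ) ≤ 1 / (c * r₁) := by
      rw [le_div_iff₀ hcr, one_mul]
      nlinarith [hc.1, hc.2, hr₁, hr₁1]
    have h2 := SuitableCompactness.isSuitableWeakSolutionInBall_of_le_radius h1 one_pos hle
    rw [hzoomv, hzoomp]
    exact h2
  -- the scaled quantities of `v'` are those of `u` at the scales `r r₁ ≤ r₁`
  have hscale : ∀ r ∈ Ioc (0 : ℝ) 1, r₁ * r ∈ Ioc (0 : ℝ) r₀ := fun r hr =>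
    ⟨mul_pos hr₁ hr.1, (mul_le_of_le_one_right hr₁.le hr.2).trans hr₁r₀⟩
  have hscale₂ : ∀ r ∈ Ioc (0 : ℝ) 1, r₁ * r ∈ Ioc (0 : ℝ) r₂ := fun r hr =>
    ⟨mul_pos hr₁ hr.1, (mul_le_of_le_one_right hr₁.le hr.2).trans hr₁r₂⟩
  have hCv' : ∀ r : ℝ, 0 < r → cknC r z₀ v' = cknC (r₁ * r) (0 : ℝ × EuclideanSpace ℝ (Fin 3)) u := by
    intro r hr
    rw [hv', hz₀0, cknC_nsZoom hr₁ hr, stAffine_zero_zero_apply_zero]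
  have hDv' : ∀ r : ℝ, 0 < r → cknD r z₀ p' = cknD (r₁ * r) (0 : ℝ × EuclideanSpace ℝ (Fin 3)) p := by
    intro r hr
    rw [hp', hz₀0, cknD_nsZoom hr₁ hr, stAffine_zero_zero_apply_zero]
  have hAv' : ∀ r : ℝ, 0 < r → cknAEss r z₀ v' = cknAEss (r₁ * r) (0 : ℝ × EuclideanSpace ℝ (Fin 3)) u := by
    intro r hr
    rw [hv', hz₀0, cknAEss_nsZoom hr₁ hr, stAffine_zero_zero_apply_zero]
  have hM : ∀ r ∈ Ioc (0 : ℝ) (1 / 2), cknC r z₀ v' ≤ K := by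
    intro r hr
    rw [hCv' r hr.1]
    have h := (hKκ (r₁ * r) (hscale r ⟨hr.1, hr.2.trans (by norm_num)⟩)).1
    exact (le_add_self.trans le_self_add).trans h
  have hD : ∀ r ∈ Ioc (0 : ℝ) (1 / 2), cknD r z₀ p' ≤ K := by
    intro r hr
    rw [hDv' r hr.1]
    exact le_add_self.trans (hKκ (r₁ * r) (hscale r ⟨hr.1, hr.2.trans (by norm_num)⟩)).1
  have hη : ∀ ρ ∈ Ioc (0 : ℝ) (1 / 2), ENNReal.ofReal κ₀ ≤ cknC ρ z₀ v' := by
    intro ρ hρ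
    rw [hCv' ρ hρ.1]
    exact hκ₀ (r₁ * ρ) (hscale₂ ρ ⟨hρ.1, hρ.2.trans (by norm_num)⟩)
  -- ### the extraction
  -- base scales for `v'`: a subsequence of `μₙ / r₁` below the dyadic scales
  have hμ' : Tendsto (fun n => μ n / r₁) atTop (𝓝 0) := by
    simpa using hμ0.div_const r₁
  obtain ⟨ψ, hψ, hψle⟩ := exists_subseq_le_dyadic hμ'
  set r : ℕ → ℝ := fun n => μ (ψ n) / r₁ with hrdef
  have hr : ∀ n, 0 < r n := fun n => div_pos (hμ _) hr₁
  have hrle : ∀ n, r n ≤ (1 / 2 : ℝ) ^ (n + 2) := fun n => hψle n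
  obtain ⟨δ, w, π, hδ, hδge, hlim⟩ := exists_zoom_blowup_limit_along hv'_meas hsuit hM hD hr hrle
  set mu : ℕ → ℝ := fun j => r (δ j) with hmu
  have hmu_pos : ∀ j, 0 < mu j := fun j => hr _
  have hmu_dy : ∀ j, mu j ≤ (1 / 2 : ℝ) ^ (δ j + 2) := fun j => hrle _
  have hmu_le : ∀ j, mu j ≤ 1 / 4 := fun j => by
    calc mu j ≤ (1 / 2 : ℝ) ^ (δ j + 2) := hmu_dy j
      _ ≤ (1 / 2) ^ 2 := pow_le_pow_of_le_one (by norm_num) (by norm_num) (by omega)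
      _ = 1 / 4 := by norm_num
  have hmur : ∀ j, mu j * r₁ = μ (ψ (δ j)) := fun j => by
    show μ (ψ (δ j)) / r₁ * r₁ = μ (ψ (δ j))
    field_simp
  refine ⟨fun j => ψ (δ j), w, π, hψ.comp hδ, ?_, ?_⟩
  · -- ### the origin is a singular point of the limit (persistence of singularities)
    have hsuit' : ∀ k, IsSuitableWeakSolutionInBall 1 0
        (mu k • stPull (mu k ^ 2) (mu k) z₀.1 z₀.2 v') (mu k ^ 2 • stPull (mu k ^ 2) (mu k) z₀.1 z₀.2 p') :=
      fun k => hsuit (mu k) ⟨hmu_pos k, (hmu_le k).trans (by norm_num)⟩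
    have hbound : (⨆ k, eLpNorm (uncurry (mu k • stPull (mu k ^ 2) (mu k) z₀.1 z₀.2 v')) 3
          (volume.restrict (parabolicCylinder 1 (0 : ℝ × EuclideanSpace ℝ (Fin 3)))) +
        eLpNorm (uncurry (mu k ^ 2 • stPull (mu k ^ 2) (mu k) z₀.1 z₀.2 p')) (3 / 2)
          (volume.restrict (parabolicCylinder 1 (0 : ℝ × EuclideanSpace ℝ (Fin 3))))) < ∞ := by
      refine lt_of_le_of_lt (iSup_le fun k => eLpNorm_zoom_add_le_of hM hD
        ⟨hmu_pos k, (hmu_le k).trans (by norm_num)⟩) ?_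
      exact ENNReal.add_lt_top.2
        ⟨ENNReal.rpow_lt_top_of_nonneg (by norm_num) ENNReal.coe_ne_top,
          ENNReal.rpow_lt_top_of_nonneg (by norm_num) ENNReal.coe_ne_top⟩
    have hconvR : ∀ R ∈ Ioo (0 : ℝ) 1,
        IsSuitableWeakSolutionInBall R 0 w π ∧
        Tendsto (fun k => eLpNorm (uncurry (mu k • stPull (mu k ^ 2) (mu k) z₀.1 z₀.2 v') - uncurry w) 3
          (volume.restrict (parabolicCylinder R (0 : ℝ × EuclideanSpace ℝ (Fin 3))))) atTop (𝓝 0) ∧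
        ∀ g : ℝ × EuclideanSpace ℝ (Fin 3) → ℝ,
          MemLp g 3 (volume.restrict (parabolicCylinder R (0 : ℝ × EuclideanSpace ℝ (Fin 3)))) →
          Tendsto (fun k => ∫ w' in parabolicCylinder R (0 : ℝ × EuclideanSpace ℝ (Fin 3)),
              (mu k ^ 2 • stPull (mu k ^ 2) (mu k) z₀.1 z₀.2 p') w'.1 w'.2 * g w')
            atTop (𝓝 (∫ w' in parabolicCylinder R (0 : ℝ × EuclideanSpace ℝ (Fin 3)),
              π w'.1 w'.2 * g w')) := by
      intro R hR
      obtain ⟨h1, -, h3, h4⟩ := hlim R hR.1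
      exact ⟨h1, h3, h4⟩
    have hblow : ∀ R ∈ Ioo (0 : ℝ) 1, limsup (fun k => eLpNorm
        (uncurry (mu k • stPull (mu k ^ 2) (mu k) z₀.1 z₀.2 v')) ∞
          (volume.restrict (parabolicCylinder R (0 : ℝ × EuclideanSpace ℝ (Fin 3))))) atTop = ∞ := by
      intro R hR
      have hall : ∀ k, eLpNorm (uncurry (mu k • stPull (mu k ^ 2) (mu k) z₀.1 z₀.2 v')) ∞
          (volume.restrict (parabolicCylinder R (0 : ℝ × EuclideanSpace ℝ (Fin 3)))) = ∞ := by
        intro k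
        rw [hzoomv, eLpNorm_top_nsZoom (mul_pos (hmu_pos k) hr₁), stAffine_zero_zero_apply_zero,
          hsing _ (by have := hmu_pos k; have := hR.1; positivity), ENNReal.mul_top]
        exact (ENNReal.ofReal_pos.2 (mul_pos (hmu_pos k) hr₁)).ne'
      simp only [hall]
      exact limsup_const ∞
    exact PersistenceOfSingularities_holds _ _ w π hsuit' hbound hconvR hblow
  · -- ### the properties on `Q(a)`
    intro a ha
    obtain ⟨h1, h2, h3, h4⟩ := hlim a ha
    obtain ⟨j₀, hj₀'⟩ := eventually_scale_mul_le_half hδge ha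
    have hj₀ : ∀ j, j₀ ≤ j → a * mu j ≤ 1 / 2 := fun j hj =>
      (mul_le_mul_of_nonneg_left (hmu_dy j) ha.le).trans (hj₀' j hj)
    -- measurability of the rescaled velocities on `Q(a)` for `j ≥ j₀`
    have hmeas : ∀ j, j₀ ≤ j → AEStronglyMeasurable
        (uncurry (mu j • stPull (mu j ^ 2) (mu j) z₀.1 z₀.2 v'))
        (volume.restrict (parabolicCylinder a (0 : ℝ × EuclideanSpace ℝ (Fin 3)))) :=
      fun j hj => aestronglyMeasurable_uncurry_zoom_of hv'_meas (hmu_pos j) ha (hj₀ j hj)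
    have hw_meas : AEStronglyMeasurable (uncurry w)
        (volume.restrict (parabolicCylinder a (0 : ℝ × EuclideanSpace ℝ (Fin 3)))) := h2.1
    refine ⟨h1, h2, ?_, ?_, ?_⟩
    · -- strong convergence of the velocities
      refine (tendsto_congr fun j => ?_).1 h3
      rw [hzoomv, hmur]
    · -- weak convergence of the pressures
      intro g hg
      have := h4 g hg
      refine (tendsto_congr fun j => ?_).1 this
      rw [hzoomp, hmur]
    · -- `C(w; a) ≥ κ₀`
      have hlow := lintegral_cube_ge_of_tendsto_along hv'_meas hη hmu_pos ha hj₀ hw_meas h3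
      have ha2 : (ENNReal.ofReal a ^ 2) ≠ 0 := pow_ne_zero _ ((ENNReal.ofReal_pos.2 ha).ne')
      have ha2' : (ENNReal.ofReal a ^ 2) ≠ ∞ := ENNReal.pow_ne_top ENNReal.ofReal_ne_top
      rw [cknC]
      refine (ENNReal.mul_le_iff_le_inv ha2 ha2').1 ?_
      rw [← ENNReal.ofReal_pow ha.le, ← ENNReal.ofReal_mul (by positivity)]
      exact hlow


end Seregin2020

end Literature.Analysis.FluidPDE

end
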